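import Mathlib
import HarnessLib
import Summits.HubbardSuperconductivity.HubbardSuperconductivity.Theorems.WeakCouplingBCSKlCertTPrimePocketRadiusContinuous
import Summits.HubbardSuperconductivity.HubbardSuperconductivity.Theorems.WeakCouplingBCSKlCertTPrimePHReflectionMeasure

/-!
# Route `WeakCouplingBCS` — certificate vocabulary for `WcbcsKohnLuttingerB1g` (stmt-HubbardSuperconductivity-0158):
# the VELOCITY and the DENSITY OF STATES of the `t′` polar chart, in closed form — brick (N1)-2b of «TPRIME-LINDHARD-HS»

Cell `gate-hubbard-kl`, seat margin-1 (g18), zero kit; executed for the p4 lineage's programme «TPRIME-LINDHARD-HS» (pen g27 (R467)(C): «(N1)-2 … + the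
`fermiPolarVelocity`/`fermiPolarDOS` twins»).  Continues `…KlCertTPrimePocketRadius.lean` ((N1)-1) and `…KlCertTPrimePocketRadiusContinuous.lean` ((N1)-2)
with the `t′`-twins of `HubbardFermiRadiusBand` §4 and `HubbardFermiRadiusBandContinuous` §3:

* `kltpRadiusDeriv tp μ θ := −∂_θF_{t′}/∂_tF_{t′}` at `t = u_{t′,μ}(θ)` (closed form; that it IS `u'` is the implicit-function brick (N1)-3);
  `kltpPolarVelocity tp μ θ := u'·dir θ + u·dir^⊥ θ`; `kltpPolarDOS tp μ θ := ‖γ'(θ)‖ / ‖∇ε_{t′}(γ(θ))‖` (the `gradient` of `squareDispersion 1 tp`, in closed form by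
  `klph_gradient_squareDispersion`, p4 g19);
* `norm_kltpPolarVelocity_sq` (`‖γ'‖² = u'² + u²`), `kltpRadius_le_norm_kltpPolarVelocity`, `kltpPolarVelocity_ne_zero`;
* **`kltpRayDt_eq_dir_gradient`** (`∂_tF_{t′}(θ, t) = dir θ · ∇ε_{t′}(t·dir θ)`), **`kltpRayDt_le_norm_gradient`** (Cauchy–Schwarz), hence
  **`norm_gradient_kltpPolar_pos`** (`0 < ∂_tF_{t′}(θ, u) ≤ ‖∇ε_{t′}(γ(θ))‖`: no critical point of `ε_{t′}` on the Γ-centred curve), **`kltpPolarDOS_pos`** and the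
  pointwise DOS bound `kltpPolarDOS_le` (`≤ ‖γ'‖/∂_tF`) — the shape of the «DOS domination» input `hσ` of `kltp_m03_HS_of_chart_TSL` (✓ p727153, p4 g23) once the
  change of variables `fermiCurveMeasure ε_{t′} μ = γ_*(kltpPolarDOS dθ)` (twin of `fermiCurveMeasure_eq_map`) is proved.

Definitions: `kltpRadiusDeriv`, `kltpPolarVelocity`, `kltpPolarDOS` (no `instance`, no `notation`).  Nothing here asserts a record, a margin, `K₃`, `U₀`, the window
or superconductivity; a Kohn–Luttinger `O(U²)` channel statement is not ODLRO; nothing here proves superconductivity in the Hubbard model.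
References: G. Benfatto, A. Giuliani, V. Mastropietro, Ann. Henri Poincaré 7 (2006) 809–898, §1 (1.5); S. Raghu, S. A. Kivelson, D. J. Scalapino, Phys. Rev. B 81
(2010) 224505, §II (6)–(8).
-/

noncomputable section

-- the tree's namespace `Summit.<Summit>.<Problem>.Theorems` repeats the summit name by design (D-0017)
set_option linter.dupNamespace false

namespace Summit.HubbardSuperconductivity.HubbardSuperconductivity.Theorems

open Real Set Filter Literature.MathematicalPhysics.QuantumLattice
open scoped Topology

/-! ### The angular derivative, the velocity and the density of states of the `t′` chart, in closed form -/

/-- **The angular derivative of the `t′` band radius in closed form**, `u' = −∂_θF_{t′}/∂_tF_{t′}` at `t = u_{t′,μ}(θ)` (that this IS the derivative is the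
implicit-function brick (N1)-3, twin of `hasDerivAt_bandFermiRadius`). [folklore] -/
def kltpRadiusDeriv (tp μ θ : ℝ) : ℝ :=
  -kltpRayDθ tp θ (kltpRadius tp μ θ) / kltpRayDt tp θ (kltpRadius tp μ θ)

/-- **The velocity of the `t′` polar parametrisation** `γ'(θ) = u'·(cos θ, sin θ) + u·(−sin θ, cos θ)` (twin of `fermiPolarVelocity`).
[cite: BenfattoGiulianiMastropietro2006, §1 (1.5)] -/
def kltpPolarVelocity (tp μ θ : ℝ) : Momentum :=
  WithLp.toLp 2 (kltpRadiusDeriv tp μ θ • dir θ + kltpRadius tp μ θ • ![-Real.sin θ, Real.cos θ])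

/-- **The density of states along the `t′` polar parametrisation**: `‖γ'(θ)‖ / ‖∇ε_{t′}(γ(θ))‖` — the density of the Fermi-curve measure `dk̂/v_F` of
`ε_{t′}` against `dθ` (twin of `fermiPolarDOS`; the change-of-variables theorem itself is a later brick). [cite: RaghuKivelsonScalapino2010, §II (8)] -/
def kltpPolarDOS (tp μ θ : ℝ) : ℝ :=
  ‖kltpPolarVelocity tp μ θ‖ / ‖gradient (squareDispersion 1 tp) (kltpPolar tp μ θ)‖

/-- The squared speed: `‖γ'(θ)‖² = u'² + u²`. [folklore] -/
theorem norm_kltpPolarVelocity_sq (tp μ θ : ℝ) :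
    ‖kltpPolarVelocity tp μ θ‖ ^ 2 = kltpRadiusDeriv tp μ θ ^ 2 + kltpRadius tp μ θ ^ 2 := by
  rw [kltpPolarVelocity, EuclideanSpace.norm_eq, Real.sq_sqrt (Finset.sum_nonneg fun i _ => by positivity),
    Fin.sum_univ_two]
  simp [dir, Real.norm_eq_abs, sq_abs]
  have := Real.cos_sq_add_sin_sq θ
  nlinarith [this]

/-- **The radial derivative is the gradient against the ray direction**: `∂_tF_{t′}(θ, t) = cos θ · ∂₀ε_{t′} + sin θ · ∂₁ε_{t′}` at `t·dir θ`, with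
`∇ε_{t′} = (2 sin k₀(1 + 2t′cos k₁), 2 sin k₁(1 + 2t′cos k₀))` (`klph_gradient_squareDispersion`). [folklore] -/
theorem kltpRayDt_eq_dir_gradient (tp θ t : ℝ) :
    kltpRayDt tp θ t = Real.cos θ * gradient (squareDispersion 1 tp) (WithLp.toLp 2 (t • dir θ)) 0 +
      Real.sin θ * gradient (squareDispersion 1 tp) (WithLp.toLp 2 (t • dir θ)) 1 := by
  rw [klph_gradient_squareDispersion]
  simp [kltpRayDt, dir, smul_eq_mul]
  ring

/-- Cauchy–Schwarz with the unit vector `(cos θ, sin θ)`: `∂_tF_{t′} ≤ ‖∇ε_{t′}‖` at the ray point. [folklore] -/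
theorem kltpRayDt_le_norm_gradient (tp θ t : ℝ) :
    kltpRayDt tp θ t ≤ ‖gradient (squareDispersion 1 tp) (WithLp.toLp 2 (t • dir θ))‖ := by
  set g := gradient (squareDispersion 1 tp) (WithLp.toLp 2 (t • dir θ)) with hg
  have hn : ‖g‖ = Real.sqrt (g 0 ^ 2 + g 1 ^ 2) := by
    rw [EuclideanSpace.norm_eq, Fin.sum_univ_two]
    simp [Real.norm_eq_abs, sq_abs]
  rw [kltpRayDt_eq_dir_gradient, ← hg, hn]
  have hcs : (Real.cos θ * g 0 + Real.sin θ * g 1) ^ 2 ≤ g 0 ^ 2 + g 1 ^ 2 := by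
    have := Real.cos_sq_add_sin_sq θ
    nlinarith [sq_nonneg (Real.cos θ * g 1 - Real.sin θ * g 0), this]
  calc Real.cos θ * g 0 + Real.sin θ * g 1 ≤ |Real.cos θ * g 0 + Real.sin θ * g 1| := le_abs_self _
    _ = Real.sqrt ((Real.cos θ * g 0 + Real.sin θ * g 1) ^ 2) := (Real.sqrt_sq_eq_abs _).symm
    _ ≤ Real.sqrt (g 0 ^ 2 + g 1 ^ 2) := Real.sqrt_le_sqrt hcs

section Window

variable {tp μ : ℝ} (htp : |tp| < 1 / 2) (hμ₁ : -4 - 4 * tp < μ) (hμ₂ : μ < 4 * tp)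
include htp hμ₁ hμ₂

/-- The speed is at least the radius: `u ≤ ‖γ'‖`. [folklore] -/
theorem kltpRadius_le_norm_kltpPolarVelocity (θ : ℝ) : kltpRadius tp μ θ ≤ ‖kltpPolarVelocity tp μ θ‖ := by
  have h := norm_kltpPolarVelocity_sq tp μ θ
  have hR := kltpRadius_pos htp hμ₁ hμ₂ θ
  nlinarith [norm_nonneg (kltpPolarVelocity tp μ θ), sq_nonneg (kltpRadiusDeriv tp μ θ)]

/-- The velocity never vanishes. [folklore] -/
theorem norm_kltpPolarVelocity_pos (θ : ℝ) : 0 < ‖kltpPolarVelocity tp μ θ‖ :=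
  (kltpRadius_pos htp hμ₁ hμ₂ θ).trans_le (kltpRadius_le_norm_kltpPolarVelocity htp hμ₁ hμ₂ θ)

/-- The velocity never vanishes. [folklore] -/
theorem kltpPolarVelocity_ne_zero (θ : ℝ) : kltpPolarVelocity tp μ θ ≠ 0 :=
  norm_pos_iff.1 (norm_kltpPolarVelocity_pos htp hμ₁ hμ₂ θ)

/-- **`∇ε_{t′} ≠ 0` on the polar curve, quantitatively**: `0 < ∂_tF_{t′}(θ, u(θ)) ≤ ‖∇ε_{t′}(γ(θ))‖` (transversality + Cauchy–Schwarz). [folklore] -/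
theorem norm_gradient_kltpPolar_pos (θ : ℝ) : 0 < ‖gradient (squareDispersion 1 tp) (kltpPolar tp μ θ)‖ :=
  (kltpRayDt_kltpRadius_pos htp hμ₁ hμ₂ θ).trans_le (kltpRayDt_le_norm_gradient tp θ _)

/-- **The density of states of the `t′` chart is positive.** [folklore] -/
theorem kltpPolarDOS_pos (θ : ℝ) : 0 < kltpPolarDOS tp μ θ :=
  div_pos (norm_kltpPolarVelocity_pos htp hμ₁ hμ₂ θ) (norm_gradient_kltpPolar_pos htp hμ₁ hμ₂ θ)

/-- The speed floor of `ε_{t′}` is INHERITED pointwise by the chart: `‖∇ε_{t′}(γ(θ))‖ ≥ ∂_tF_{t′}(θ, u(θ)) > 0`, so `kltpPolarDOS ≤ ‖γ'‖/∂_tF`. [folklore] -/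
theorem kltpPolarDOS_le (θ : ℝ) :
    kltpPolarDOS tp μ θ ≤ ‖kltpPolarVelocity tp μ θ‖ / kltpRayDt tp θ (kltpRadius tp μ θ) :=
  div_le_div_of_nonneg_left (norm_nonneg _) (kltpRayDt_kltpRadius_pos htp hμ₁ hμ₂ θ) (kltpRayDt_le_norm_gradient tp θ _)

end Window

end Summit.HubbardSuperconductivity.HubbardSuperconductivity.Theorems

end
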